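import Mathlib
import Summits.MatrixMultiplication.MatrixMultiplication.Theses.MatrixPointInterpolation
import Summits.MatrixMultiplication.MatrixMultiplication.Theorems.TightWindows.Negative.CornerPair
import Summits.MatrixMultiplication.MatrixMultiplication.Theorems.TightWindows.Negative.CornerWindow

/-!
# `MatrixPointInterpolation.TightWindows` (stmt-MatrixMultiplication-18939) is FALSE:
# the five-point corner pair — an unconditional, sorry-free refutation

`TightWindows` claims: for every point size `k ≥ 2` and `ε > 0`, eventually (in `n`) every pair
`A ∈ M_n(ℂ)²` that generates `M_n` by words of length `≤ d` and masquerades as `M_k` to degree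
`2d` has a window (the span of the word functions of length `≤ 2d` on `M_k(ℂ)²`) of dimension
`≤ n^(2+ε)`.

**Witness.** `k = 5`, `ε = 1`, `n = n₁ + 2`, `d = 2n`, `A = (N, E)` with `N` the subdiagonal
nilpotent shift (`N e_j = e_{j+1}`) and `E = E_{1n}` the corner matrix unit
(`TightWindowsNeg.corner_pair_exists`, part 1: generation in degree `2n` by
`N^p E N^{n-1-q} = E_{pq}`, and the gap law — every word with `≥ k ≥ 1` letters `E` and length
`≤ (k-1)n` vanishes at `A`).

* Few letters (`TightWindowsNeg.coeff_eq_zero_of_count_lt`, part 2, the PI input, folklore — the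
  two-letter form of the staircase argument, Kanel-Belov–Karasik–Rowen 2015 Remark 1.4.2): a
  two-letter identity of `M_k(ℂ)` has ZERO coefficient on every word with fewer than `k`
  letters `y`.
* Masquerade (`TightWindowsNeg.masquerade_of_gap_law`, part 3): split `Σ_{w ∈ T} c_w w(A)` termwise — `c_w = 0` when
  `#E(w) < 5`, `w(A) = 0` when `#E(w) ≥ 5` and `|w| ≤ 4n`.
* Loose window (`TightWindowsNeg.window_finrank_ge`, part 3): the `n⁴` word functions
  `B ↦ (x^{a₀} y x^{a₁} y x^{a₂} y x^{a₃} y)(B)` (`aᵢ < n`, length `≤ 4n = 2d`) are linearly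
  independent on `M₅(ℂ)²` (few letters again), so the window has dimension `≥ n⁴ > n³ = n^{2+ε}`
  — contradiction (`MatrixPointInterpolationTightWindows_refuted`).

Remark (not stated here — positive conclusions are a prover's landing): parts 1–2 give
`LongMasquerade` (item 18938) with `k = 5` in three lines (`corner_pair_exists n₀` and
`masquerade_of_gap_law n₀`), hence the kill target `WindowedKaplansky` (item 18945) is false.
Provenance: refuter skeleton-vet of `Cruxes/LongMasquerade/FivePointCornerSketch.lean`
(crux idea `five-point-corner`), whose typed-only `tightWindows_false_of_corner` this discharges.
-/

/-- **Record of the dropped route item `TightWindows`** = stmt-MatrixMultiplication-18939 (ledger signature verbatim; NOT a route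
item): route MatrixPointInterpolation rev 5 (2026-08-17T14:38Z) dropped the refuted `TightWindows`. The declaration `Summit.MatrixMultiplication.MatrixMultiplication.Theses.MatrixPointInterpolation.TightWindows`
therefore no longer exists in the route file and this accepted module stopped elaborating (stale olean;
buildfix lane 2026-08-19). Re-created here under its original name so the result keeps building; the
statement of every previously accepted declaration in this file is unchanged. -/
def _root_.Summit.MatrixMultiplication.MatrixMultiplication.Theses.MatrixPointInterpolation.TightWindows : Prop :=
  ∀ k : ℕ, 2 ≤ k → ∀ ε : ℝ, 0 < ε → ∃ n₁ : ℕ, ∀ (n d : ℕ) (A : Fin 2 → Matrix (Fin n) (Fin n) ℂ), n₁ ≤ n → Submodule.span ℂ {M : Matrix (Fin n) (Fin n) ℂ | ∃ w : List (Fin 2), w.length ≤ d ∧ (w.map A).prod = M} = ⊤ → (∀ (T : Finset (List (Fin 2))) (c : List (Fin 2) → ℂ), (∀ w ∈ T, w.length ≤ 2 * d) → (∀ B : Fin 2 → Matrix (Fin k) (Fin k) ℂ, (∑ w ∈ T, c w • (w.map B).prod) = 0) → (∑ w ∈ T, c w • (w.map A).prod) = 0) → (Module.finrank ℂ (Submodule.span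 ℂ {f : (Fin 2 → Matrix (Fin k) (Fin k) ℂ) → Matrix (Fin k) (Fin k) ℂ | ∃ w : List (Fin 2), w.length ≤ 2 * d ∧ f = fun B => (w.map B).prod}) : ℝ) ≤ (n : ℝ) ^ ((2 : ℝ) + ε)


namespace Summit.MatrixMultiplication.MatrixMultiplication.Theorems

open scoped BigOperators
open Summit.MatrixMultiplication.MatrixMultiplication.Theses.MatrixPointInterpolation
open TightWindowsNeg

/-- Refutes `MatrixPointInterpolation.TightWindows` [refuted-substantive]: masquerading pairs
need NOT generate tightly — at `k = 5`, `ε = 1` the corner pair `(N, E_{1n})` of every size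
`n ≥ 2` generates `M_n(ℂ)` in degree `d = 2n` and masquerades as `M₅(ℂ)` to degree `4n`, while the
word functions of length `≤ 4n` on `M₅(ℂ)²` span a space of dimension `≥ n⁴ > n³ = n^(2+ε)`;
witness `n = n₁ + 2` against any threshold `n₁`.  No cheap repair: taking `d` to be the exact
generation length (`2n - 2`, window `4n - 4 ≤ 4n`) is still killed by the same pair; restricting to
`k ≤ 4` evades this pair, but every letter-counting masquerade lives at generation length `≳ n`,
where the window carries `≥ n^(k-1)` independent functions, and in-tree `TightWindowsLoose`
(`LooseMasquerades.lean`) shows every masquerade loose by `n^(2/k²)` modulo the named PI facts —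
the content the route needs is a TIGHT / few-point restatement of `LongMasquerade`, a different
crux.  barrier-candidate: interpolation at `k × k` matrix points through a degree window is
exponent-inert — a pair masquerading as `M_k` to twice its generation degree forces a window of
dimension `≫ n^(2+ε)` ("InterpolationWindowBarrier"). [folklore] -/
theorem MatrixPointInterpolationTightWindows_refuted :
    ¬ Summit.MatrixMultiplication.MatrixMultiplication.Theses.MatrixPointInterpolation.TightWindows := by
  intro hT
  obtain ⟨n₁, h⟩ := hT 5 (by norm_num) 1 one_pos
  obtain ⟨A, hspan, hgap⟩ := corner_pair_exists (n₁ + 1)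
  have h1 := h (n₁ + 1 + 1) (2 * (n₁ + 1 + 1)) A (by omega) hspan
    (fun T c hT' hid => masquerade_of_gap_law (n₁ + 1) A hgap T c hT' hid)
  have h2 := window_finrank_ge (n₁ + 1)
  have h3 : ((n₁ + 1 + 1 : ℕ) : ℝ) ^ ((2 : ℝ) + 1) = (((n₁ + 1 + 1) ^ 3 : ℕ) : ℝ) := by
    rw [show (2 : ℝ) + 1 = ((3 : ℕ) : ℝ) by norm_num, Real.rpow_natCast]
    push_cast
    ring
  rw [h3] at h1
  have h2' : (((n₁ + 1 + 1) ^ 4 : ℕ) : ℝ) ≤ (Module.finrank ℂ (Submodule.span ℂ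
      {f : (Fin 2 → Matrix (Fin 5) (Fin 5) ℂ) → Matrix (Fin 5) (Fin 5) ℂ |
        ∃ w : List (Fin 2), w.length ≤ 2 * (2 * (n₁ + 1 + 1)) ∧ f = fun B => (w.map B).prod}) : ℝ) := by
    exact_mod_cast h2
  have h4 : (n₁ + 1 + 1) ^ 4 ≤ (n₁ + 1 + 1) ^ 3 := by exact_mod_cast h2'.trans h1
  have h5 : (n₁ + 1 + 1) ^ 3 < (n₁ + 1 + 1) ^ 4 := Nat.pow_lt_pow_right (by omega) (by norm_num)
  omega

end Summit.MatrixMultiplication.MatrixMultiplication.Theorems
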